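import Literature.MathematicalPhysics.QuantumFieldTheory.BalabanImbrieJaffe1984to88.BIJ88Smooth43Axial
import Literature.MathematicalPhysics.QuantumFieldTheory.BalabanImbrieJaffe1984to88.BIJ88Regularity286
import Literature.MathematicalPhysics.QuantumFieldTheory.BalabanImbrieJaffe1984to88.BIJ88SmallCoupling23

/-!
# `BalabanImbrieJaffe1984to88.BIJ88Smooth43AxialRegular` — T. Bałaban, J. Imbrie, A. Jaffe, *Effective action and cluster properties
of the abelian Higgs model*, Commun. Math. Phys. **114** (1988) 257–315 [BalabanImbrieJaffe1988], Sect. 5.6 p. 286 [PDF 30] with (4.3)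
p. 274 and (2.3)/(2.33): file 2 of 2 after `BIJ88Smooth43Axial` — r18's (4.3) predicate `BIJ88Sect4Statements.Smooth43` and r16's
cube-family predicate `BIJ88Regularity286.Regular286` INHABITED for the unit-lattice U(1) field from the (4.5) plaquette restriction
(the p. 286 step *"first checking it for u"*), and the smallness *"e ≪ 1"* DISCHARGED for `e_k → 0⁺`; theorems only.

statement-level skeleton of published theorems with citation tags; proofs where landed; nothing here is a claim about the Yang–Mills mass gap

PDF held: `paper:balaban1988-cmp114-bij-abelian-higgs-effective-action` (journal page = PDF page + 256); pp. 274, 286 [PDF 18, 30].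

CITATION HEADER (lean-in-tree rule).  Part of the lit-balaban TYPED SKELETON (HOME `run/shared/lean/pub/lit-balaban/`), PHASE-2
proof seat p36 gen 6 (unit `lit-balaban-p36`; TAKING line HOME/STATUS.md 2026-08-21T09:44Z).  WHAT IS REPRODUCED: rows
**C2.Claim@286** (owner r16; the located sentence *"In □′ … we can write u = exp[ie_k(∂λ + B)] with |B(b)| ≦ cp(e_k)r(e_k). We have
f^{(k)} = ∂B in the cube"*) and **C2.Eq4.3** (owner r18; (4.3) p. 274 verbatim: *"there exists a gauge transformation u_k → u_k^λ
such that u^λ_{k,b} = exp(ie_jL^{−j}A^λ_b) with |A^λ_b|, |(∂^ζA^λ)(p)|, |(∂^{ζ*}A^λ)(x)| ≦ cp(e_j)r(e_j) (4.3) in □"* — so far inhabited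
only by `u ≡ 1`, `BIJ88Regularity286.smooth43_one`).

WHAT IS PROVED (0 `sorry`, standard axioms; theorems only, no `def`).  With the axial potential `B = BIJ88Smooth43Axial.axialB e_k U lo hi`
of file 1 (`|B| ≦ (π/2)(d−1)na`, `∂B = f^{(k)}` exactly, `|∂*B| ≦ πd(d−1)na` on a non-wrapping box of `n + 1` sites per direction where
`|arg u(p)| ≦ e_ka`, `(2π(d−1)n + 1)e_ka < 2π`):
* §3 **`smooth43_of_plaquettes`**: `Smooth43 e_k 1 c′ p(e_k) r(e_k) X Bs Pl (cfg U)`, `c′ = c(1 + πd(d−1)N)`, for every finite set of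
  sites `X`, of box bonds `Bs` and of box plaquettes `Pl`, from `|arg u(p)| ≦ e_k·c·p(e_k)` on the box plaquettes, `n ≦ N·r(e_k)`,
  `r(e_k) ≧ 1` and the smallness (witnesses `lamOf (axialGauge U lo hi)`, `axialB`); `smooth43_of_fieldStrength` (the same from the
  printed form `|f^{(k)}(p)| ≦ cp(e_k)`, `f^{(k)} = (ie_k)⁻¹ log u(p)` = r18's `fieldStrength`).
* §4 `starB_subset_boxBonds` / `starP_subset_boxPlaqs` (one lattice unit of slack puts `□*`, `□**` inside the box bonds/plaquettes) and
  **`regular286_of_plaquettes`**: `Regular286 cube G e_k 1 c′ p(e_k) r(e_k) (cfg U)` for every family `G` of cubes each sitting with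
  slack in a non-wrapping box carrying the plaquette restriction.
* §5 *"e ≪ 1"* (p. 273): `tendsto_mul_absLogInv_rpow` (`e·|log e⁻¹|^s → 0` as `e → 0⁺`), **`eventually_smallness`**
  (`(K·r(e_k) + 1)·e_k·c·p(e_k) < 2π` eventually, r18's (2.3) `rLen` and (2.33) `pLog`; with `K = 2π(d−1)N` this is the smallness
  hypothesis of §3 for all boxes of `≦ N·r(e_k) + 1` sites per direction), `exists_smallness_threshold`.
HONEST SCOPE.  As file 1: the FIRST printed step only (the unit-lattice field `u`); the η-lattice passage (5.6.3)–(5.6.5) to `u_k`/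
`ũ_{k+1}` and the kernel bounds it needs are NOT touched (r16's `BIJ88Regularity286` note stands); non-wrapping boxes only; constants
explicit, not optimised.  Seat p36 gen 6 (literature-prover-lit-balaban-p36-g6-0), 2026-08-21.  NOT summit progress.
-/

namespace Literature.MathematicalPhysics.QuantumFieldTheory.BalabanImbrieJaffe1984to88.BIJ88Smooth43AxialRegular

open Balaban1983to89 hiding Site Plaq
open Balaban1983to89.LatticeFieldCalculus Balaban1983to89.T4AxialGaugeSmallField
open BIJ88Sect3Statements (U1 toC norm_toC cfg gaugeU plaqVar fieldStrength starB starP mem_starB)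
open BIJ88Sect4Statements (Smooth43)
open BIJ88Regularity286 (Regular286 cubeSites)
open BIJ88Ineq217NearPart (e_add_e_apply_le)
open BIJ88Smooth43Axial
open Balaban1983to89.B7Prop1Explicit (e e_apply)
open BIJ88Sect2Statements (rLen pLog)
open Complex Filter
open scoped Real Topology

noncomputable section

open Balaban1983to89 renaming Site → TSite, Plaq → TPlaq

variable {P : Params} {j : ℕ}

/-! ## §3  (4.3) INHABITED for the unit-lattice field from the plaquette restriction -/

/-- The constant of the conclusion dominates the three bounds. [folklore] -/
private theorem const_bounds {c pek rek : ℝ} {n N : ℕ} {d : ℕ} (hc : 0 ≤ c) (hpek : 0 ≤ pek) (hrek : 1 ≤ rek)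
    (hnr : (n : ℝ) ≤ N * rek) :
    π / 2 * (((d - 1 : ℕ) : ℝ) * n * (c * pek)) ≤ c * (1 + π * d * ((d - 1 : ℕ) : ℝ) * N) * pek * rek ∧
      c * pek ≤ c * (1 + π * d * ((d - 1 : ℕ) : ℝ) * N) * pek * rek ∧
      π * d * (((d - 1 : ℕ) : ℝ) * n * (c * pek)) ≤ c * (1 + π * d * ((d - 1 : ℕ) : ℝ) * N) * pek * rek := by
  have hπ := Real.pi_pos.le
  have hd1 : (0 : ℝ) ≤ ((d - 1 : ℕ) : ℝ) := Nat.cast_nonneg _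
  have hd : (0 : ℝ) ≤ (d : ℝ) := Nat.cast_nonneg _
  have hcp : 0 ≤ c * pek := mul_nonneg hc hpek
  have hN : (0 : ℝ) ≤ N := Nat.cast_nonneg _
  have hrek0 : 0 ≤ rek := zero_le_one.trans hrek
  -- the common quantity `Q = (d−1)·N·(c p)·r ≥ 0` and the rewriting of the target constant
  set Q := ((d - 1 : ℕ) : ℝ) * N * (c * pek) * rek with hQ
  have hQ0 : 0 ≤ Q := mul_nonneg (mul_nonneg (mul_nonneg hd1 hN) hcp) hrek0
  have hcpr : 0 ≤ c * pek * rek := mul_nonneg hcp hrek0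
  have htarget : c * (1 + π * d * ((d - 1 : ℕ) : ℝ) * N) * pek * rek = c * pek * rek + π * d * Q := by
    rw [hQ]; ring
  have hX : ((d - 1 : ℕ) : ℝ) * n * (c * pek) ≤ Q := by
    calc ((d - 1 : ℕ) : ℝ) * n * (c * pek) ≤ ((d - 1 : ℕ) : ℝ) * (N * rek) * (c * pek) :=
          mul_le_mul_of_nonneg_right (mul_le_mul_of_nonneg_left hnr hd1) hcp
      _ = Q := by rw [hQ]; ring
  -- `(π/2)·Q ≤ π·d·Q`: trivial for `d = 0` (then `Q = 0`), else `π/2 ≤ π ≤ π d`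
  have hhalf : π / 2 * Q ≤ π * d * Q := by
    rcases Nat.eq_zero_or_pos d with h0 | hpos
    · subst h0
      have : Q = 0 := by rw [hQ]; simp
      rw [this]; simp
    · have hd1' : (1 : ℝ) ≤ d := by exact_mod_cast hpos
      have : π / 2 ≤ π * d := by nlinarith
      exact mul_le_mul_of_nonneg_right this hQ0
  rw [htarget]
  refine ⟨?_, ?_, ?_⟩
  · calc π / 2 * (((d - 1 : ℕ) : ℝ) * n * (c * pek)) ≤ π / 2 * Q := mul_le_mul_of_nonneg_left hX (by positivity)
      _ ≤ π * d * Q := hhalf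
      _ ≤ c * pek * rek + π * d * Q := le_add_of_nonneg_left hcpr
  · calc c * pek ≤ c * pek * rek := le_mul_of_one_le_right hcp hrek
      _ ≤ c * pek * rek + π * d * Q := le_add_of_nonneg_right (by positivity)
  · calc π * d * (((d - 1 : ℕ) : ℝ) * n * (c * pek)) ≤ π * d * Q := mul_le_mul_of_nonneg_left hX (by positivity)
      _ ≤ c * pek * rek + π * d * Q := le_add_of_nonneg_left hcpr

/-- **(4.3) INHABITED — THE p. 286 STEP «first checking it for u»**: if the plaquette angles of the unit-lattice `U(1)` field satisfy
`|arg u(p)| ≦ e_k·c·p(e_k)` (the (4.5) restriction `|f^{(k)}(p)| ≦ cp(e_k)`) on the plaquettes of a non-wrapping box `[lo, hi]` of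
`n + 1 ≦ N·r(e_k) + 1` sites per direction, `r(e_k) ≧ 1`, and `(2π(d−1)n + 1)e_kcp(e_k) < 2π` (*"e ≪ 1"*), then r18's
`Smooth43 e_k 1 c′ p(e_k) r(e_k) X Bs Pl u` holds with `c′ = c(1 + πd(d−1)N)` for every finite set of sites `X`, of box bonds `Bs` and
of box plaquettes `Pl` — witnesses: the gauge function `lamOf (axialGauge U lo hi)` and the axial potential `axialB`.
[cite: BalabanImbrieJaffe1988, (4.3) p.286] -/
theorem smooth43_of_plaquettes (U : GaugeField P j U1) {lo hi : Fin P.d → ℤ} {n N : ℕ} {ek c pek rek : ℝ} (hek : 0 < ek)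
    (hc : 0 ≤ c) (hpek : 0 ≤ pek) (hrek : 1 ≤ rek) (hn : ∀ κ, hi κ ≤ lo κ + n) (hnN : n < P.sitesPerDir j)
    (hnr : (n : ℝ) ≤ N * rek) (hf : ∀ p ∈ boxPlaqs lo hi, |arg (plaqVar (cfg U) p)| ≤ ek * (c * pek))
    (hsmall : (2 * π * ((P.d - 1 : ℕ) : ℝ) * n + 1) * (ek * (c * pek)) < 2 * π)
    {X : Finset (TSite P j)} {Bs : Finset (PBond P j)} {Pl : Finset (TPlaq P j)} (hBs : ∀ b ∈ Bs, b ∈ boxBonds lo hi)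
    (hPl : ∀ p ∈ Pl, p ∈ boxPlaqs lo hi) :
    Smooth43 ek 1 (c * (1 + π * P.d * ((P.d - 1 : ℕ) : ℝ) * N)) pek rek X Bs Pl (cfg U) := by
  have hcp : 0 ≤ c * pek := mul_nonneg hc hpek
  obtain ⟨k1, k2, k3⟩ := const_bounds (d := P.d) (n := n) (N := N) hc hpek hrek hnr
  refine ⟨lamOf (axialGauge U lo hi), axialB ek U lo hi, fun b hb => ?_, fun b _ => ?_, fun p hp => ?_, fun x _ => ?_⟩
  · rw [mul_one]; exact gaugeU_axial_eq_exp hek.ne' U (hBs b hb)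
  · exact (abs_axialB_le hek hcp U hf hn hnN b).trans k1
  · rw [inv_one]; exact (abs_curl_axialB_le hek hcp U hf hn hnN hsmall (hPl p hp)).trans k2
  · rw [inv_one]; exact (abs_diverg_axialB_le hek hcp U hf hn hnN x).trans k3

/-- The same from the PRINTED form of the restriction, `|f^{(k)}(p)| ≦ cp(e_k)` with `f^{(k)} = (ie_k)⁻¹ log u(p)` (r18's
`fieldStrength`). [cite: BalabanImbrieJaffe1988, (4.3) p.286] -/
theorem smooth43_of_fieldStrength (U : GaugeField P j U1) {lo hi : Fin P.d → ℤ} {n N : ℕ} {ek c pek rek : ℝ} (hek : 0 < ek)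
    (hc : 0 ≤ c) (hpek : 0 ≤ pek) (hrek : 1 ≤ rek) (hn : ∀ κ, hi κ ≤ lo κ + n) (hnN : n < P.sitesPerDir j)
    (hnr : (n : ℝ) ≤ N * rek) (hf : ∀ p ∈ boxPlaqs lo hi, ‖fieldStrength ek (plaqVar (cfg U) p)‖ ≤ c * pek)
    (hsmall : (2 * π * ((P.d - 1 : ℕ) : ℝ) * n + 1) * (ek * (c * pek)) < 2 * π)
    {X : Finset (TSite P j)} {Bs : Finset (PBond P j)} {Pl : Finset (TPlaq P j)} (hBs : ∀ b ∈ Bs, b ∈ boxBonds lo hi)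
    (hPl : ∀ p ∈ Pl, p ∈ boxPlaqs lo hi) :
    Smooth43 ek 1 (c * (1 + π * P.d * ((P.d - 1 : ℕ) : ℝ) * N)) pek rek X Bs Pl (cfg U) :=
  smooth43_of_plaquettes U hek hc hpek hrek hn hnN hnr
    (fun p hp => (abs_arg_le_iff_norm_fieldStrength_le hek U p _).2 (hf p hp)) hsmall hBs hPl

/-! ## §4  The cube-family form: r16's `Regular286` from the plaquette restriction -/

/-- GEOMETRY: if every site of `X` lifts to a box point with one lattice unit of slack on top (`lo ≦ z`, `z + 1 ≦ hi` coordinatewise),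
then every bond with both (indeed: with its initial) endpoint in `X` is a box bond. [cite: BalabanImbrieJaffe1988, (3.5) p.266] -/
theorem starB_subset_boxBonds {X : Finset (TSite P j)} {lo hi : Fin P.d → ℤ}
    (hX : ∀ x ∈ X, ∃ z : Fin P.d → ℤ, lo ≤ z ∧ (∀ κ, z κ + 1 ≤ hi κ) ∧ (castSite z : TSite P j) = x) :
    ∀ b ∈ starB X, b ∈ boxBonds lo hi := by
  intro b hb
  rw [mem_starB] at hb
  obtain ⟨z, hlo, hhi, hz⟩ := hX b.src hb.1
  refine ⟨z, hlo, fun κ => ?_, hz.symm⟩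
  have h1 := hhi κ
  have h2 : e b.dir κ ≤ 1 := by rw [e_apply]; split_ifs <;> omega
  simp only [Pi.add_apply]
  linarith

/-- GEOMETRY: under the same slack, every plaquette based in `X` (in particular every plaquette with all four corners in `X`) is a box
plaquette (`e_μ + e_ν ≦ 1` coordinatewise for `μ ≠ ν`). [cite: BalabanImbrieJaffe1988, (3.5) p.266] -/
theorem starP_subset_boxPlaqs {X : Finset (TSite P j)} {lo hi : Fin P.d → ℤ}
    (hX : ∀ x ∈ X, ∃ z : Fin P.d → ℤ, lo ≤ z ∧ (∀ κ, z κ + 1 ≤ hi κ) ∧ (castSite z : TSite P j) = x) :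
    ∀ p ∈ starP X, p ∈ boxPlaqs lo hi := by
  intro p hp
  simp only [starP, Finset.mem_filter, Finset.mem_univ, true_and] at hp
  obtain ⟨z, hlo, hhi, hz⟩ := hX p.src hp.1
  refine ⟨z, hlo, fun κ => ?_, hz.symm⟩
  have h1 := hhi κ
  have h2 := e_add_e_apply_le (ne_of_lt p.hμν) κ
  simp only [Pi.add_apply]
  linarith

/-- **r16's `Regular286` from the plaquette restriction** (p. 286, for the unit-lattice field): if every cube `□` of the family
`G` sits — with one lattice unit of slack — in a non-wrapping box `□′ = [lo □, hi □]` of `n + 1` sites per direction,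
`n ≦ N·r(e_k)`, on whose plaquettes `|arg u(p)| ≦ e_k·c·p(e_k)`, and `(2π(d−1)n + 1)e_kcp(e_k) < 2π`, then
`Regular286 cube G e_k 1 c′ p(e_k) r(e_k) (cfg U)` with `c′ = c(1 + πd(d−1)N)`. [cite: BalabanImbrieJaffe1988, (4.3) p.286] -/
theorem regular286_of_plaquettes {γ : Type*} (cube : TSite P j → γ) (G : Set γ) (U : GaugeField P j U1)
    (lo hi : γ → Fin P.d → ℤ) {n N : ℕ} {ek c pek rek : ℝ} (hek : 0 < ek) (hc : 0 ≤ c) (hpek : 0 ≤ pek) (hrek : 1 ≤ rek)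
    (hn : ∀ g ∈ G, ∀ κ, hi g κ ≤ lo g κ + n) (hnN : n < P.sitesPerDir j) (hnr : (n : ℝ) ≤ N * rek)
    (hin : ∀ g ∈ G, ∀ x ∈ cubeSites cube g, ∃ z : Fin P.d → ℤ, lo g ≤ z ∧ (∀ κ, z κ + 1 ≤ hi g κ) ∧ (castSite z : TSite P j) = x)
    (hf : ∀ g ∈ G, ∀ p ∈ boxPlaqs (lo g) (hi g), |arg (plaqVar (cfg U) p)| ≤ ek * (c * pek))
    (hsmall : (2 * π * ((P.d - 1 : ℕ) : ℝ) * n + 1) * (ek * (c * pek)) < 2 * π) :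
    Regular286 cube G ek 1 (c * (1 + π * P.d * ((P.d - 1 : ℕ) : ℝ) * N)) pek rek (cfg U) :=
  fun g hg => smooth43_of_plaquettes U hek hc hpek hrek (hn g hg) hnN hnr (hf g hg) hsmall
    (starB_subset_boxBonds (hin g hg)) (starP_subset_boxPlaqs (hin g hg))

/-! ## §5  The smallness is automatic for `e_k` small (p. 273 *"e ≪ 1"*; (2.3) `r(e_k) = |log e_k⁻¹|^r`, (2.33) `p(e_k) = |log e_k⁻¹|^p`) -/

/-- `e·|log e⁻¹|^s → 0` as `e → 0⁺`, for every real `s`. [cite: BalabanImbrieJaffe1988, (2.33) p.263] -/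
theorem tendsto_mul_absLogInv_rpow (s : ℝ) : Tendsto (fun ek : ℝ => ek * |Real.log ek⁻¹| ^ s) (𝓝[>] 0) (𝓝 0) := by
  have h1 : Tendsto (fun u : ℝ => u ^ s * Real.exp (-1 * u)) atTop (𝓝 0) :=
    tendsto_rpow_mul_exp_neg_mul_atTop_nhds_zero s 1 one_pos
  have h2 := h1.comp BIJ88SmallCoupling23.tendsto_abs_log_inv
  refine h2.congr' ?_
  have hlt : ∀ᶠ ek : ℝ in 𝓝[>] 0, ek < 1 := nhdsWithin_le_nhds (Iio_mem_nhds zero_lt_one)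
  filter_upwards [hlt, self_mem_nhdsWithin] with ek hek1 (hek0 : 0 < ek)
  have hlog : |Real.log ek⁻¹| = -Real.log ek := by
    rw [Real.log_inv, abs_neg, abs_of_nonpos (Real.log_nonpos hek0.le hek1.le)]
  simp only [Function.comp_apply]
  rw [hlog, neg_mul, one_mul, neg_neg, Real.exp_log hek0, mul_comm]

/-- **THE SMALLNESS HYPOTHESIS HOLDS FOR `e_k` SMALL**: for every `K`, `c`, `p`, `r`, eventually in `e_k → 0⁺`
`(K·r(e_k) + 1)·(e_k·c·p(e_k)) < 2π` — with `K = 2π(d−1)N` this is `hsmall` of `smooth43_of_plaquettes` for all boxes of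
`≦ N·r(e_k) + 1` sites per direction. [cite: BalabanImbrieJaffe1988, (2.3) p.260] -/
theorem eventually_smallness (K c p r : ℝ) :
    ∀ᶠ ek : ℝ in 𝓝[>] 0, (K * rLen r ek + 1) * (ek * (c * pLog p ek)) < 2 * π := by
  -- the expression is eventually `K·c·(e|log e⁻¹|^{r+p}) + c·(e|log e⁻¹|^p)`, and both summands tend to `0`
  have hT : Tendsto (fun ek : ℝ => K * c * (ek * |Real.log ek⁻¹| ^ (r + p)) + c * (ek * |Real.log ek⁻¹| ^ p))
      (𝓝[>] 0) (𝓝 (K * c * 0 + c * 0)) :=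
    ((tendsto_mul_absLogInv_rpow (r + p)).const_mul (K * c)).add ((tendsto_mul_absLogInv_rpow p).const_mul c)
  rw [mul_zero, mul_zero, add_zero] at hT
  have hev := hT.eventually (gt_mem_nhds Real.two_pi_pos)
  have hlt : ∀ᶠ ek : ℝ in 𝓝[>] 0, ek < 1 := nhdsWithin_le_nhds (Iio_mem_nhds zero_lt_one)
  filter_upwards [hev, hlt, self_mem_nhdsWithin] with ek hek hek1 (hek0 : 0 < ek)
  have hpos : 0 < |Real.log ek⁻¹| := by
    rw [abs_pos, Real.log_inv, neg_ne_zero]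
    exact Real.log_ne_zero_of_pos_of_ne_one hek0 hek1.ne
  have hsplit : (K * rLen r ek + 1) * (ek * (c * pLog p ek)) =
      K * c * (ek * |Real.log ek⁻¹| ^ (r + p)) + c * (ek * |Real.log ek⁻¹| ^ p) := by
    rw [rLen, pLog, Real.rpow_add hpos]
    ring
  rw [hsplit]
  exact hek

/-- Threshold form: `∃ δ > 0` such that the smallness holds for all `0 < e_k < δ` (`BIJ88SmallChargeRegime.exists_threshold` is not
imported here; the two-line extraction is repeated). [cite: BalabanImbrieJaffe1988, (2.3) p.260] -/
theorem exists_smallness_threshold (K c p r : ℝ) :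
    ∃ δ > 0, ∀ ek : ℝ, 0 < ek → ek < δ → (K * rLen r ek + 1) * (ek * (c * pLog p ek)) < 2 * π := by
  obtain ⟨δ, hδ, h⟩ := (nhdsGT_basis (0 : ℝ)).eventually_iff.mp (eventually_smallness K c p r)
  exact ⟨δ, hδ, fun ek h0 h1 => h ⟨h0, h1⟩⟩

end

end Literature.MathematicalPhysics.QuantumFieldTheory.BalabanImbrieJaffe1984to88.BIJ88Smooth43AxialRegular
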